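import Literature.Probability.RandomPlanarGeometry.ObliqueRBMWedgePullback
import HarnessLib

/-!
# The oblique harmonic test functions as `OrbmTestData`

Layer of the proof of
`Literature.Probability.RandomPlanarGeometry.LawlerSchrammWerner2001_orbm_uniformHitting`
(`ObliqueRBMWedge.lean`). From the pulled-back objects `G, G₁, G₂` of
`ObliqueRBMWedgePullback.lean` we build, for every level `0 < M' < N`, a term
`TestIntervals.testData : OrbmTestData M'` (`ObliqueRBMWedgeDynkin.lean`) whose test function is
`F = Re G` on the closed triangle `levelRegion N`:

* geometry of the closed/open triangles (compact, convex; interior approximation by shrinking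
  towards an interior point);
* the Lipschitz bound for `G₁` on `levelRegion M'` (mean value inequality on the open triangle +
  closure), giving the Lipschitz form of the oblique boundary conditions from the exact ones on
  the sides (`re_E₁_mul_dirSixty_of_neg`, `re_E₁_of_one_lt`);
* the second-order Taylor estimate with the modulus of continuity of `G₂` (integral remainder
  along segments of the open triangle + closure);
* the values `F(0) = Re Φ(∞)` and `F(oppositeSideParam N s) = Re Φₑ(scRatioInv s)`.

## References

* J. Dubédat, Ann. IHP 40 (2004), §4; W. Werner, LNM 1840 (2004), Ch. 5 §5.1. [Dubedat2004]
-/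

noncomputable section

open Set Filter Topology Complex Metric MeasureTheory intervalIntegral
open scoped Real Interval
open UpperHalfPlane (upperHalfPlaneSet isOpen_upperHalfPlaneSet)

namespace Literature.Probability.RandomPlanarGeometry

/-! ### Geometry of the closed and open triangles -/

/-- Auxiliary statement (`quadX_smul`). [folklore] -/
theorem quadX_smul (a : ℝ) (z : ℂ) : quadX (a • z) = a * quadX z := by
  simp [quadX, mul_div_assoc, mul_sub]

/-- Auxiliary statement (`quadY_smul`). [folklore] -/
theorem quadY_smul (a : ℝ) (z : ℂ) : quadY (a • z) = a * quadY z := by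
  simp [quadY]; ring

/-- Auxiliary statement (`isLinearMap_quadX`). [folklore] -/
theorem isLinearMap_quadX : IsLinearMap ℝ quadX := ⟨quadX_add, quadX_smul⟩

/-- Auxiliary statement (`isLinearMap_quadY`). [folklore] -/
theorem isLinearMap_quadY : IsLinearMap ℝ quadY := ⟨quadY_add, quadY_smul⟩

/-- Auxiliary statement (`isLinearMap_level`). [folklore] -/
theorem isLinearMap_level : IsLinearMap ℝ fun z ↦ quadX z + quadY z :=
  ⟨fun a b ↦ by rw [quadX_add, quadY_add]; ring, fun a z ↦ by rw [quadX_smul, quadY_smul]; simp [mul_add]⟩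

/-- `levelRegion M` is convex. [folklore] -/
theorem convex_levelRegion (M : ℝ) : Convex ℝ (levelRegion M) := by
  have h1 : Convex ℝ {z : ℂ | 0 ≤ quadX z} := convex_halfSpace_ge isLinearMap_quadX 0
  have h2 : Convex ℝ {z : ℂ | 0 ≤ quadY z} := convex_halfSpace_ge isLinearMap_quadY 0
  have h3 : Convex ℝ {z : ℂ | quadX z + quadY z ≤ M} := convex_halfSpace_le isLinearMap_level M
  have : levelRegion M = {z : ℂ | 0 ≤ quadX z} ∩ ({z : ℂ | 0 ≤ quadY z} ∩ {z : ℂ | quadX z + quadY z ≤ M}) := by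
    ext z; simp [levelRegion]
  rw [this]; exact h1.inter (h2.inter h3)

/-- `openTri M` is convex. [folklore] -/
theorem convex_openTri (M : ℝ) : Convex ℝ (openTri M) := by
  have h1 : Convex ℝ {z : ℂ | 0 < quadX z} := convex_halfSpace_gt isLinearMap_quadX 0
  have h2 : Convex ℝ {z : ℂ | 0 < quadY z} := convex_halfSpace_gt isLinearMap_quadY 0
  have h3 : Convex ℝ {z : ℂ | quadX z + quadY z < M} := convex_halfSpace_lt isLinearMap_level M
  have : openTri M = {z : ℂ | 0 < quadX z} ∩ ({z : ℂ | 0 < quadY z} ∩ {z : ℂ | quadX z + quadY z < M}) := by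
    ext z; simp [openTri]
  rw [this]; exact h1.inter (h2.inter h3)

/-- Auxiliary statement (`isClosed_levelRegion`). [folklore] -/
theorem isClosed_levelRegion (M : ℝ) : IsClosed (levelRegion M) := by
  have : levelRegion M = {z : ℂ | 0 ≤ quadX z} ∩ ({z : ℂ | 0 ≤ quadY z} ∩ {z : ℂ | quadX z + quadY z ≤ M}) := by
    ext z; simp [levelRegion]
  rw [this]
  exact (isClosed_le continuous_const continuous_quadX).inter ((isClosed_le continuous_const continuous_quadY).inter
    (isClosed_le (continuous_quadX.add continuous_quadY) continuous_const))

/-- Auxiliary statement (`norm_dirSixty`). [folklore] -/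
theorem norm_dirSixty : ‖dirSixty‖ = 1 := by
  rw [dirSixty]; exact Complex.norm_exp_ofReal_mul_I _

/-- `‖z‖ ≤ quadX z + quadY z` on the closed wedge coordinates. [folklore] -/
theorem norm_le_level {z : ℂ} (hx : 0 ≤ quadX z) (hy : 0 ≤ quadY z) : ‖z‖ ≤ quadX z + quadY z := by
  conv_lhs => rw [← quadX_add_quadY_mul_dirSixty z]
  refine (norm_add_le _ _).trans ?_
  rw [Complex.norm_real, Real.norm_eq_abs, abs_of_nonneg hx, norm_mul, Complex.norm_real, Real.norm_eq_abs,
    abs_of_nonneg hy, norm_dirSixty, mul_one]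

/-- `levelRegion M` is compact. [folklore] -/
theorem isCompact_levelRegion (M : ℝ) : IsCompact (levelRegion M) := by
  refine Metric.isCompact_of_isClosed_isBounded (isClosed_levelRegion M) ?_
  refine (Metric.isBounded_closedBall (x := (0:ℂ)) (r := M)).subset fun z hz ↦ ?_
  rw [mem_closedBall, dist_zero_right]
  exact (norm_le_level hz.1 hz.2.1).trans hz.2.2

/-- Auxiliary statement (`openTri_subset_levelRegion`). [folklore] -/
theorem openTri_subset_levelRegion (M : ℝ) : openTri M ⊆ levelRegion M :=
  fun _ hz ↦ ⟨hz.1.le, hz.2.1.le, hz.2.2.le⟩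

/-- Auxiliary statement (`openTri_mono`). [folklore] -/
theorem openTri_mono {M N : ℝ} (h : M ≤ N) : openTri M ⊆ openTri N :=
  fun _ hz ↦ ⟨hz.1, hz.2.1, lt_of_lt_of_le hz.2.2 h⟩

/-- The interior reference point `c₀ = (M/3) + (M/3) ζ` of the triangle of level `M`. [folklore] -/
def triCenter (M : ℝ) : ℂ := ((M / 3 : ℝ) : ℂ) + ((M / 3 : ℝ) : ℂ) * dirSixty

/-- Auxiliary statement (`quadX_triCenter`). [folklore] -/
theorem quadX_triCenter (M : ℝ) : quadX (triCenter M) = M / 3 := by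
  rw [triCenter, quadX_add, quadX_ofReal, quadX_ofReal_mul_dirSixty, add_zero]

/-- Auxiliary statement (`quadY_triCenter`). [folklore] -/
theorem quadY_triCenter (M : ℝ) : quadY (triCenter M) = M / 3 := by
  rw [triCenter, quadY_add, quadY_ofReal, quadY_ofReal_mul_dirSixty, zero_add]

/-- The shrinking map `p_t(z) = c₀ + t (z − c₀)`. [folklore] -/
def shrink (M : ℝ) (t : ℝ) (z : ℂ) : ℂ := triCenter M + (t : ℂ) * (z - triCenter M)

/-- Auxiliary statement (`shrink_eq_smul`). [folklore] -/
theorem shrink_eq (M t : ℝ) (z : ℂ) : shrink M t z = (1 - t) • triCenter M + t • z := by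
  simp only [shrink, real_smul]; push_cast; ring

/-- Auxiliary statement (`quadX_shrink`). [folklore] -/
theorem quadX_shrink (M t : ℝ) (z : ℂ) : quadX (shrink M t z) = (1 - t) * (M / 3) + t * quadX z := by
  rw [shrink_eq, quadX_add, quadX_smul, quadX_smul, quadX_triCenter]

/-- Auxiliary statement (`quadY_shrink`). [folklore] -/
theorem quadY_shrink (M t : ℝ) (z : ℂ) : quadY (shrink M t z) = (1 - t) * (M / 3) + t * quadY z := by
  rw [shrink_eq, quadY_add, quadY_smul, quadY_smul, quadY_triCenter]

/-- For `t ∈ [0, 1)` the shrunk point of the closed triangle is in the open triangle. [folklore] -/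
theorem shrink_mem_openTri {M : ℝ} (hM : 0 < M) {t : ℝ} (ht : t ∈ Ico (0:ℝ) 1) {z : ℂ} (hz : z ∈ levelRegion M) :
    shrink M t z ∈ openTri M := by
  obtain ⟨hx, hy, hl⟩ := hz
  have h1t : 0 < 1 - t := by linarith [ht.2]
  refine ⟨?_, ?_, ?_⟩
  · rw [quadX_shrink]; nlinarith [ht.1]
  · rw [quadY_shrink]; nlinarith [ht.1]
  · rw [quadX_shrink, quadY_shrink]; nlinarith [ht.1]

/-- `p_t(z) → z` as `t → 1`. [folklore] -/
theorem tendsto_shrink (M : ℝ) (z : ℂ) : Tendsto (fun t : ℝ ↦ shrink M t z) (𝓝 1) (𝓝 z) := by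
  have : Continuous fun t : ℝ ↦ shrink M t z := by unfold shrink; fun_prop
  have h := this.tendsto 1
  simp only [shrink, ofReal_one, one_mul, add_sub_cancel] at h
  exact h

/-- `p_t(z) → z` within the closed triangle as `t → 1⁻` (for `z` in the closed triangle). [folklore] -/
theorem tendsto_shrink_nhdsWithin {M : ℝ} (hM : 0 < M) {z : ℂ} (hz : z ∈ levelRegion M) :
    Tendsto (fun t : ℝ ↦ shrink M t z) (𝓝[<] 1) (𝓝[levelRegion M] z) := by
  refine tendsto_nhdsWithin_iff.2 ⟨(tendsto_shrink M z).mono_left nhdsWithin_le_nhds, ?_⟩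
  filter_upwards [Ico_mem_nhdsLT (zero_lt_one' ℝ)] with t ht
  exact openTri_subset_levelRegion M (shrink_mem_openTri hM ht hz)

/-- Auxiliary statement (`shrink_sub_shrink`). [folklore] -/
theorem shrink_sub_shrink (M t : ℝ) (z z' : ℂ) : shrink M t z' - shrink M t z = (t : ℂ) * (z' - z) := by
  unfold shrink; ring

/-- Auxiliary statement (`norm_shrink_sub_shrink`). [folklore] -/
theorem norm_shrink_sub_shrink {t : ℝ} (ht : t ∈ Ico (0:ℝ) 1) (M : ℝ) (z z' : ℂ) :
    ‖shrink M t z' - shrink M t z‖ ≤ ‖z' - z‖ := by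
  rw [shrink_sub_shrink, norm_mul, Complex.norm_real, Real.norm_eq_abs, abs_of_nonneg ht.1]
  exact mul_le_of_le_one_left (norm_nonneg _) ht.2.le

/-! ### Bounds and the modulus of continuity -/

/-- The sup norm of `f` over `K`. [folklore] -/
def normBound (f : ℂ → ℂ) (K : Set ℂ) : ℝ := sSup ((fun z ↦ ‖f z‖) '' K)

/-- Auxiliary statement (`bddAbove_norm_image`). [folklore] -/
theorem bddAbove_norm_image {f : ℂ → ℂ} {K : Set ℂ} (hK : IsCompact K) (hf : ContinuousOn f K) :
    BddAbove ((fun z ↦ ‖f z‖) '' K) := by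
  obtain ⟨C, hC⟩ := hK.exists_bound_of_continuousOn hf
  exact ⟨C, by rintro _ ⟨z, hz, rfl⟩; exact hC z hz⟩

/-- Auxiliary statement (`norm_le_normBound`). [folklore] -/
theorem norm_le_normBound {f : ℂ → ℂ} {K : Set ℂ} (hK : IsCompact K) (hf : ContinuousOn f K) {z : ℂ} (hz : z ∈ K) :
    ‖f z‖ ≤ normBound f K :=
  le_csSup (bddAbove_norm_image hK hf) ⟨z, hz, rfl⟩

/-- Auxiliary statement (`normBound_nonneg`). [folklore] -/
theorem normBound_nonneg (f : ℂ → ℂ) (K : Set ℂ) : 0 ≤ normBound f K :=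
  Real.sSup_nonneg (by rintro _ ⟨z, _, rfl⟩; exact norm_nonneg _)

/-- **The modulus of continuity** of `f` on `K`:
`ω(r) = sup {‖f p − f q‖ : p, q ∈ K, ‖p − q‖ ≤ r}`. [folklore] -/
def modulus (f : ℂ → ℂ) (K : Set ℂ) (r : ℝ) : ℝ :=
  sSup ((fun pq : ℂ × ℂ ↦ ‖f pq.1 - f pq.2‖) '' {pq | pq.1 ∈ K ∧ pq.2 ∈ K ∧ ‖pq.1 - pq.2‖ ≤ r})

/-- Auxiliary statement (`modulus_nonneg`). [folklore] -/
theorem modulus_nonneg (f : ℂ → ℂ) (K : Set ℂ) (r : ℝ) : 0 ≤ modulus f K r :=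
  Real.sSup_nonneg (by rintro _ ⟨pq, _, rfl⟩; exact norm_nonneg _)

/-- Auxiliary statement (`modulus_le_two_mul`). [folklore] -/
theorem modulus_le {f : ℂ → ℂ} {K : Set ℂ} (hK : IsCompact K) (hf : ContinuousOn f K) (r : ℝ) :
    modulus f K r ≤ 2 * normBound f K := by
  refine Real.sSup_le ?_ (mul_nonneg zero_le_two (normBound_nonneg f K))
  rintro _ ⟨pq, hpq, rfl⟩
  calc ‖f pq.1 - f pq.2‖ ≤ ‖f pq.1‖ + ‖f pq.2‖ := norm_sub_le _ _
    _ ≤ normBound f K + normBound f K := add_le_add (norm_le_normBound hK hf hpq.1) (norm_le_normBound hK hf hpq.2.1)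
    _ = 2 * normBound f K := by ring

/-- Auxiliary statement (`bddAbove_modulus_set`). [folklore] -/
theorem bddAbove_modulus_set {f : ℂ → ℂ} {K : Set ℂ} (hK : IsCompact K) (hf : ContinuousOn f K) (r : ℝ) :
    BddAbove ((fun pq : ℂ × ℂ ↦ ‖f pq.1 - f pq.2‖) '' {pq | pq.1 ∈ K ∧ pq.2 ∈ K ∧ ‖pq.1 - pq.2‖ ≤ r}) := by
  refine ⟨2 * normBound f K, ?_⟩
  rintro _ ⟨pq, hpq, rfl⟩
  calc ‖f pq.1 - f pq.2‖ ≤ ‖f pq.1‖ + ‖f pq.2‖ := norm_sub_le _ _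
    _ ≤ normBound f K + normBound f K := add_le_add (norm_le_normBound hK hf hpq.1) (norm_le_normBound hK hf hpq.2.1)
    _ = 2 * normBound f K := by ring

/-- **The defining bound**: `‖f p − f q‖ ≤ ω(r)` whenever `p, q ∈ K`, `‖p − q‖ ≤ r`. [folklore] -/
theorem norm_sub_le_modulus {f : ℂ → ℂ} {K : Set ℂ} (hK : IsCompact K) (hf : ContinuousOn f K) {p q : ℂ}
    (hp : p ∈ K) (hq : q ∈ K) {r : ℝ} (hr : ‖p - q‖ ≤ r) : ‖f p - f q‖ ≤ modulus f K r :=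
  le_csSup (bddAbove_modulus_set hK hf r) ⟨(p, q), ⟨hp, hq, hr⟩, rfl⟩

/-- Auxiliary statement (`modulus_mono`). [folklore] -/
theorem modulus_mono {f : ℂ → ℂ} {K : Set ℂ} (hK : IsCompact K) (hf : ContinuousOn f K) : Monotone (modulus f K) := by
  intro r r' hrr'
  by_cases hne : ({pq : ℂ × ℂ | pq.1 ∈ K ∧ pq.2 ∈ K ∧ ‖pq.1 - pq.2‖ ≤ r}).Nonempty
  · exact csSup_le_csSup (bddAbove_modulus_set hK hf r') (hne.image _)
      (image_mono fun pq hpq ↦ ⟨hpq.1, hpq.2.1, hpq.2.2.trans hrr'⟩)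
  · rw [not_nonempty_iff_eq_empty] at hne
    rw [modulus, hne, image_empty, Real.sSup_empty]
    exact modulus_nonneg f K r'

/-- **`ω(r) → 0` as `r ↓ 0`** (uniform continuity on the compact `K`). [folklore] -/
theorem tendsto_modulus {f : ℂ → ℂ} {K : Set ℂ} (hK : IsCompact K) (hf : ContinuousOn f K) :
    Tendsto (modulus f K) (𝓝[>] 0) (𝓝 0) := by
  have hunif := hK.uniformContinuousOn_of_continuous hf
  rw [Metric.uniformContinuousOn_iff] at hunif
  rw [Metric.tendsto_nhdsWithin_nhds]
  intro ε hε
  obtain ⟨δ, hδ, hδε⟩ := hunif (ε / 2) (half_pos hε)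
  refine ⟨δ, hδ, fun r hr hrδ ↦ ?_⟩
  rw [Real.dist_eq, sub_zero, abs_of_nonneg (modulus_nonneg f K r)]
  rw [Real.dist_eq, sub_zero, abs_of_pos (mem_Ioi.1 hr)] at hrδ
  have hle : modulus f K r ≤ ε / 2 := by
    refine Real.sSup_le ?_ (by linarith)
    rintro _ ⟨pq, hpq, rfl⟩
    have := hδε pq.1 hpq.1 pq.2 hpq.2.1 (by rw [dist_eq_norm]; exact lt_of_le_of_lt hpq.2.2 hrδ)
    rw [dist_eq_norm] at this
    exact this.le
  linarith

/-! ### The Lipschitz bound for `G₁` and the oblique boundary conditions -/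

namespace TestIntervals

variable (D : TestIntervals)

/-- The sup of `‖G₂‖` on `levelRegion M'`. [folklore] -/
def C₂bound (N M' : ℝ) : ℝ := normBound (D.G₂fun N) (levelRegion M')

/-- The sup of `‖G₁‖` on `levelRegion M'`. [folklore] -/
def C₁bound (N M' : ℝ) : ℝ := normBound (D.G₁fun N) (levelRegion M')

/-- **Lipschitz bound on the open triangle** (mean value inequality). [folklore] -/
theorem norm_G₁fun_sub_le_open {N M' : ℝ} (hN : 0 < N) (hM' : M' < N) {a b : ℂ} (ha : a ∈ openTri M')
    (hb : b ∈ openTri M') : ‖D.G₁fun N b - D.G₁fun N a‖ ≤ D.C₂bound N M' * ‖b - a‖ := by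
  have hK := isCompact_levelRegion M'
  have hG₂ := D.continuousOn_G₂fun hN hM'
  refine (convex_openTri M').norm_image_sub_le_of_norm_hasDerivWithin_le
    (f := D.G₁fun N) (f' := D.G₂fun N) (fun x hx ↦ ?_) (fun x hx ↦ ?_) ha hb
  · exact (D.hasDerivAt_G₁fun hN (openTri_mono hM'.le hx)).hasDerivWithinAt
  · exact norm_le_normBound hK hG₂ (openTri_subset_levelRegion M' hx)

/-- **Lipschitz bound on the closed triangle** (closure of the open-triangle bound). [folklore] -/
theorem norm_G₁fun_sub_le {N M' : ℝ} (hN : 0 < N) (hM'0 : 0 < M') (hM' : M' < N) {z z' : ℂ}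
    (hz : z ∈ levelRegion M') (hz' : z' ∈ levelRegion M') :
    ‖D.G₁fun N z' - D.G₁fun N z‖ ≤ D.C₂bound N M' * ‖z' - z‖ := by
  have hG₁ := D.continuousOn_G₁fun hN hM'
  -- along the shrinking family
  have hlim : Tendsto (fun t : ℝ ↦ ‖D.G₁fun N (shrink M' t z') - D.G₁fun N (shrink M' t z)‖) (𝓝[<] 1)
      (𝓝 ‖D.G₁fun N z' - D.G₁fun N z‖) :=
    (((hG₁ z' hz').tendsto.comp (tendsto_shrink_nhdsWithin hM'0 hz')).sub
      ((hG₁ z hz).tendsto.comp (tendsto_shrink_nhdsWithin hM'0 hz))).norm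
  have hlim' : Tendsto (fun t : ℝ ↦ D.C₂bound N M' * ‖shrink M' t z' - shrink M' t z‖) (𝓝[<] 1)
      (𝓝 (D.C₂bound N M' * ‖z' - z‖)) :=
    (((tendsto_shrink M' z').sub (tendsto_shrink M' z)).norm.mono_left nhdsWithin_le_nhds).const_mul _
  refine le_of_tendsto_of_tendsto hlim hlim' ?_
  filter_upwards [Ico_mem_nhdsLT (zero_lt_one' ℝ)] with t ht
  exact D.norm_G₁fun_sub_le_open hN hM' (shrink_mem_openTri hM'0 ht hz) (shrink_mem_openTri hM'0 ht hz')

/-- **Exact oblique condition on the side `quadY = 0`**: `Re(G₁(z) ζ) = 0`. [folklore] -/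
theorem re_G₁fun_mul_dirSixty_eq_zero {N M' : ℝ} (hN : 0 < N) (hM' : M' < N) {z : ℂ} (hz : z ∈ levelRegion M')
    (hy : quadY z = 0) : (D.G₁fun N z * dirSixty).re = 0 := by
  by_cases hz0 : z = 0
  · subst hz0; simp
  · have hzp : z ∈ puncturedRegion N := levelRegion_diff_subset hM'.le ⟨hz, hz0⟩
    have hl : quadX z + quadY z < N := lt_of_le_of_lt hz.2.2 hM'
    obtain ⟨him, hre⟩ := wInv_of_quadY_eq_zero hN hzp hl hy
    have heq : wInv N z = (((wInv N z).re : ℝ) : ℂ) := Complex.ext (by simp) (by simp [him])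
    rw [D.G₁fun_of_ne N hz0, heq]
    exact D.re_E₁_mul_dirSixty_of_neg hN.ne' hre

/-- **Exact oblique condition on the side `quadX = 0`**: `Re G₁(z) = 0`. [folklore] -/
theorem re_G₁fun_eq_zero {N M' : ℝ} (hN : 0 < N) (hM' : M' < N) {z : ℂ} (hz : z ∈ levelRegion M')
    (hx : quadX z = 0) : (D.G₁fun N z).re = 0 := by
  by_cases hz0 : z = 0
  · subst hz0; simp
  · have hzp : z ∈ puncturedRegion N := levelRegion_diff_subset hM'.le ⟨hz, hz0⟩
    have hl : quadX z + quadY z < N := lt_of_le_of_lt hz.2.2 hM'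
    obtain ⟨him, hre⟩ := wInv_of_quadX_eq_zero hN hzp hl hx
    have heq : wInv N z = (((wInv N z).re : ℝ) : ℂ) := Complex.ext (by simp) (by simp [him])
    rw [D.G₁fun_of_ne N hz0, heq]
    exact D.re_E₁_of_one_lt hN.ne' hre

/-- **Lipschitz form of the condition on the side `quadY = 0`**:
`|Re(G₁(z) ζ)| ≤ C quadY z`. [folklore] -/
theorem abs_re_G₁fun_mul_dirSixty_le {N M' : ℝ} (hN : 0 < N) (hM'0 : 0 < M') (hM' : M' < N) {z : ℂ}
    (hz : z ∈ levelRegion M') : |(D.G₁fun N z * dirSixty).re| ≤ D.C₂bound N M' * quadY z := by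
  -- foot point on the side
  set z₀ : ℂ := ((quadX z : ℝ) : ℂ) with hz₀
  have hz₀mem : z₀ ∈ levelRegion M' := by
    refine ⟨by rw [hz₀, quadX_ofReal]; exact hz.1, by rw [hz₀, quadY_ofReal], ?_⟩
    rw [hz₀, quadX_ofReal, quadY_ofReal, add_zero]; linarith [hz.2.1, hz.2.2]
  have h0 := D.re_G₁fun_mul_dirSixty_eq_zero hN hM' hz₀mem (by rw [hz₀, quadY_ofReal])
  have hdiff : z - z₀ = ((quadY z : ℝ) : ℂ) * dirSixty := by
    have hzdec := quadX_add_quadY_mul_dirSixty z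
    have e : ((quadX z : ℝ) : ℂ) + ((quadY z : ℝ) : ℂ) * dirSixty - ((quadX z : ℝ) : ℂ) = ((quadY z : ℝ) : ℂ) * dirSixty := by
      ring
    rw [hz₀, ← e, hzdec]
  have hnorm : ‖z - z₀‖ = quadY z := by
    rw [hdiff, norm_mul, Complex.norm_real, Real.norm_eq_abs, abs_of_nonneg hz.2.1, norm_dirSixty, mul_one]
  have hL := D.norm_G₁fun_sub_le hN hM'0 hM' hz₀mem hz
  calc |(D.G₁fun N z * dirSixty).re| = |(D.G₁fun N z * dirSixty).re - (D.G₁fun N z₀ * dirSixty).re| := by rw [h0, sub_zero]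
    _ = |((D.G₁fun N z - D.G₁fun N z₀) * dirSixty).re| := by rw [sub_mul, sub_re]
    _ ≤ ‖(D.G₁fun N z - D.G₁fun N z₀) * dirSixty‖ := abs_re_le_norm _
    _ = ‖D.G₁fun N z - D.G₁fun N z₀‖ := by rw [norm_mul, norm_dirSixty, mul_one]
    _ ≤ D.C₂bound N M' * ‖z - z₀‖ := hL
    _ = D.C₂bound N M' * quadY z := by rw [hnorm]

/-- **Lipschitz form of the condition on the side `quadX = 0`**: `|Re G₁(z)| ≤ C quadX z`. [folklore] -/
theorem abs_re_G₁fun_le {N M' : ℝ} (hN : 0 < N) (hM'0 : 0 < M') (hM' : M' < N) {z : ℂ} (hz : z ∈ levelRegion M') :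
    |(D.G₁fun N z).re| ≤ D.C₂bound N M' * quadX z := by
  set z₀ : ℂ := ((quadY z : ℝ) : ℂ) * dirSixty with hz₀
  have hz₀mem : z₀ ∈ levelRegion M' := by
    refine ⟨by rw [hz₀, quadX_ofReal_mul_dirSixty], by rw [hz₀, quadY_ofReal_mul_dirSixty]; exact hz.2.1, ?_⟩
    rw [hz₀, quadX_ofReal_mul_dirSixty, quadY_ofReal_mul_dirSixty, zero_add]; linarith [hz.1, hz.2.2]
  have h0 := D.re_G₁fun_eq_zero hN hM' hz₀mem (by rw [hz₀, quadX_ofReal_mul_dirSixty])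
  have hdiff : z - z₀ = ((quadX z : ℝ) : ℂ) := by
    have hzdec := quadX_add_quadY_mul_dirSixty z
    have e : ((quadX z : ℝ) : ℂ) + ((quadY z : ℝ) : ℂ) * dirSixty - ((quadY z : ℝ) : ℂ) * dirSixty = ((quadX z : ℝ) : ℂ) := by
      ring
    rw [hz₀, ← e, hzdec]
  have hnorm : ‖z - z₀‖ = quadX z := by
    rw [hdiff, Complex.norm_real, Real.norm_eq_abs, abs_of_nonneg hz.1]
  have hL := D.norm_G₁fun_sub_le hN hM'0 hM' hz₀mem hz
  calc |(D.G₁fun N z).re| = |(D.G₁fun N z).re - (D.G₁fun N z₀).re| := by rw [h0, sub_zero]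
    _ = |(D.G₁fun N z - D.G₁fun N z₀).re| := by rw [sub_re]
    _ ≤ ‖D.G₁fun N z - D.G₁fun N z₀‖ := abs_re_le_norm _
    _ ≤ D.C₂bound N M' * ‖z - z₀‖ := hL
    _ = D.C₂bound N M' * quadX z := by rw [hnorm]

/-! ### The second-order Taylor estimate -/

/-- The complex Taylor remainder `T(a, b) = G(b) − G(a) − G₁(a)(b−a) − G₂(a)(b−a)²/2`. [folklore] -/
def taylorRem (N : ℝ) (a b : ℂ) : ℂ :=
  D.Gfun N b - D.Gfun N a - D.G₁fun N a * (b - a) - D.G₂fun N a * (b - a) ^ 2 / 2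

/-- The modulus of continuity of `G₂` on `levelRegion M'`. [folklore] -/
def omega (N M' : ℝ) : ℝ → ℝ := modulus (D.G₂fun N) (levelRegion M')

/-- **Taylor estimate on the open triangle**:
`‖T(a,b)‖ ≤ ω(‖b − a‖) ‖b − a‖²` (integral form of the remainder along the segment). [folklore] -/
theorem norm_taylorRem_le_open {N M' : ℝ} (hN : 0 < N) (hM' : M' < N) {a b : ℂ} (ha : a ∈ openTri M')
    (hb : b ∈ openTri M') : ‖D.taylorRem N a b‖ ≤ D.omega N M' ‖b - a‖ * ‖b - a‖ ^ 2 := by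
  set Δ := b - a with hΔ
  have hK := isCompact_levelRegion M'
  have hG₂ := D.continuousOn_G₂fun hN hM'
  -- the segment stays in the open triangle
  have hseg : ∀ t ∈ Icc (0:ℝ) 1, a + (t : ℂ) * Δ ∈ openTri M' := by
    intro t ht
    have : a + (t : ℂ) * Δ = (1 - t) • a + t • b := by rw [hΔ]; simp only [real_smul]; push_cast; ring
    rw [this]
    exact (convex_openTri M') ha hb (by linarith [ht.2]) ht.1 (by ring)
  have hsegN : ∀ t ∈ Icc (0:ℝ) 1, a + (t : ℂ) * Δ ∈ openTri N := fun t ht ↦ openTri_mono hM'.le (hseg t ht)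
  -- `h(t) = G(a + tΔ) + (1 - t) Δ G₁(a + tΔ) + (1 - t)²/2 · Δ² G₂(a)`
  set h : ℝ → ℂ := fun t ↦ D.Gfun N (a + t * Δ) + (1 - (t : ℂ)) * Δ * D.G₁fun N (a + t * Δ)
    + (1 - (t : ℂ)) ^ 2 / 2 * Δ ^ 2 * D.G₂fun N a with hh
  set h' : ℝ → ℂ := fun t ↦ (1 - (t : ℂ)) * Δ ^ 2 * (D.G₂fun N (a + t * Δ) - D.G₂fun N a) with hh'
  have hderiv : ∀ t ∈ uIcc (0:ℝ) 1, HasDerivAt h (h' t) t := by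
    intro t ht
    rw [uIcc_of_le zero_le_one] at ht
    have hγ : HasDerivAt (fun s : ℂ ↦ a + s * Δ) Δ (t : ℂ) := by
      simpa using ((hasDerivAt_id (t : ℂ)).mul_const Δ).const_add a
    have hG0 := D.hasDerivAt_Gfun hN (hsegN t ht)
    have hGc := hG0.comp (t : ℂ) hγ
    have hG := hGc.comp_ofReal
    have hG₁0 := D.hasDerivAt_G₁fun hN (hsegN t ht)
    have hG₁c := hG₁0.comp (t : ℂ) hγ
    have hG₁ := hG₁c.comp_ofReal
    have hlin : HasDerivAt (fun s : ℝ ↦ (1 - (s : ℂ)) * Δ) (-Δ) t := by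
      have := ((hasDerivAt_const (t : ℂ) (1:ℂ)).sub (hasDerivAt_id (t : ℂ))).mul_const Δ
      simp only [zero_sub, neg_mul, one_mul] at this
      exact this.comp_ofReal
    have hsq : HasDerivAt (fun s : ℝ ↦ (1 - (s : ℂ)) ^ 2 / 2 * Δ ^ 2 * D.G₂fun N a)
        (((2:ℕ) * (1 - (t : ℂ)) ^ (2 - 1) * (0 - 1)) / 2 * Δ ^ 2 * D.G₂fun N a) t := by
      have h1 : HasDerivAt (fun s : ℂ ↦ (1 - s)) (0 - 1) (t : ℂ) := (hasDerivAt_const _ (1:ℂ)).sub (hasDerivAt_id _)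
      exact ((((h1.fun_pow 2).div_const 2).mul_const (Δ ^ 2)).mul_const (D.G₂fun N a)).comp_ofReal
    have hsum := (hG.add (hlin.mul hG₁)).add hsq
    refine hsum.congr_deriv ?_
    rw [hh']; simp only [Function.comp_apply]; push_cast; ring
  have hint : IntervalIntegrable h' volume 0 1 := by
    refine ContinuousOn.intervalIntegrable ?_
    rw [uIcc_of_le zero_le_one]
    have hγc : Continuous fun t : ℝ ↦ a + (t : ℂ) * Δ := by fun_prop
    have hG₂c : ContinuousOn (fun t : ℝ ↦ D.G₂fun N (a + t * Δ)) (Icc 0 1) :=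
      hG₂.comp hγc.continuousOn fun t ht ↦ openTri_subset_levelRegion M' (hseg t ht)
    exact ((continuous_const.sub continuous_ofReal).mul continuous_const).continuousOn.mul
      (hG₂c.sub continuousOn_const)
  have hFTC := intervalIntegral.integral_eq_sub_of_hasDerivAt hderiv hint
  have h1 : h 1 = D.Gfun N b := by rw [hh]; simp [hΔ]
  have h0 : h 0 = D.Gfun N a + Δ * D.G₁fun N a + Δ ^ 2 * D.G₂fun N a / 2 := by rw [hh]; simp; ring
  have hT : D.taylorRem N a b = ∫ t in (0:ℝ)..1, h' t := by
    rw [hFTC, h1, h0, taylorRem, ← hΔ]; ring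
  rw [hT]
  -- bound the integrand: `‖h' t‖ ≤ ω(‖Δ‖) ‖Δ‖²` on `[0,1]`
  have hbound : ∀ t ∈ Ι (0:ℝ) 1, ‖h' t‖ ≤ D.omega N M' ‖Δ‖ * ‖Δ‖ ^ 2 := by
    intro t ht
    rw [uIoc_of_le zero_le_one] at ht
    have ht' : t ∈ Icc (0:ℝ) 1 := ⟨ht.1.le, ht.2⟩
    have hpt : a + (t : ℂ) * Δ ∈ levelRegion M' := openTri_subset_levelRegion M' (hseg t ht')
    have hpa : a ∈ levelRegion M' := openTri_subset_levelRegion M' ha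
    have hdist : ‖(a + (t : ℂ) * Δ) - a‖ ≤ ‖Δ‖ := by
      rw [add_sub_cancel_left, norm_mul, Complex.norm_real, Real.norm_eq_abs, abs_of_nonneg ht.1.le]
      exact mul_le_of_le_one_left (norm_nonneg _) ht.2
    have hω := norm_sub_le_modulus hK hG₂ hpt hpa hdist
    rw [hh']
    simp only [norm_mul, norm_pow]
    have h1t : ‖1 - (t : ℂ)‖ ≤ 1 := by
      rw [show (1:ℂ) - t = ((1 - t : ℝ) : ℂ) by push_cast; ring, Complex.norm_real, Real.norm_eq_abs,
        abs_of_nonneg (by linarith [ht.2])]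
      linarith [ht.1]
    calc ‖1 - (t : ℂ)‖ * ‖Δ‖ ^ 2 * ‖D.G₂fun N (a + t * Δ) - D.G₂fun N a‖ ≤ 1 * ‖Δ‖ ^ 2 * D.omega N M' ‖Δ‖ := by
          gcongr
          exact hω
      _ = D.omega N M' ‖Δ‖ * ‖Δ‖ ^ 2 := by ring
  have := intervalIntegral.norm_integral_le_of_norm_le_const hbound
  simpa using this

/-- The real Taylor expression of `OrbmTestData` is the real part of the complex remainder.
[folklore] -/
theorem re_taylorRem (N : ℝ) (a b : ℂ) :
    (D.taylorRem N a b).re = (D.Gfun N b).re - (D.Gfun N a).re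
      - ((D.G₁fun N a).re * (b - a).re + (-(D.G₁fun N a).im) * (b - a).im)
      - ((D.G₂fun N a).re * (b - a).re ^ 2 + 2 * (-(D.G₂fun N a).im) * (b - a).re * (b - a).im
          + (-(D.G₂fun N a).re) * (b - a).im ^ 2) / 2 := by
  simp only [taylorRem, sub_re, mul_re, div_ofNat_re, sq, sub_im, mul_im]
  ring

/-- **Taylor estimate on the closed triangle** (closure of the open-triangle estimate along the
shrinking family, using monotonicity of `ω`). [folklore] -/
theorem norm_taylorRem_le {N M' : ℝ} (hN : 0 < N) (hM'0 : 0 < M') (hM' : M' < N) {z z' : ℂ}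
    (hz : z ∈ levelRegion M') (hz' : z' ∈ levelRegion M') :
    ‖D.taylorRem N z z'‖ ≤ D.omega N M' ‖z' - z‖ * ‖z' - z‖ ^ 2 := by
  have hK := isCompact_levelRegion M'
  have hG := (D.continuousOn_Gfun hN).mono (levelRegion_mono hM'.le)
  have hG₁ := D.continuousOn_G₁fun hN hM'
  have hG₂ := D.continuousOn_G₂fun hN hM'
  set K : ℝ := D.omega N M' ‖z' - z‖ with hKdef
  -- limits along the shrinking family
  have tz := tendsto_shrink_nhdsWithin hM'0 hz
  have tz' := tendsto_shrink_nhdsWithin hM'0 hz'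
  have hlim : Tendsto (fun t : ℝ ↦ ‖D.taylorRem N (shrink M' t z) (shrink M' t z')‖) (𝓝[<] 1)
      (𝓝 ‖D.taylorRem N z z'‖) := by
    refine Tendsto.norm ?_
    unfold taylorRem
    have e1 := (hG z' hz').tendsto.comp tz'
    have e2 := (hG z hz).tendsto.comp tz
    have e3 := (hG₁ z hz).tendsto.comp tz
    have e4 := (hG₂ z hz).tendsto.comp tz
    have e5 : Tendsto (fun t : ℝ ↦ shrink M' t z' - shrink M' t z) (𝓝[<] 1) (𝓝 (z' - z)) :=
      ((tendsto_shrink M' z').sub (tendsto_shrink M' z)).mono_left nhdsWithin_le_nhds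
    exact ((e1.sub e2).sub (e3.mul e5)).sub ((e4.mul (e5.pow 2)).div_const 2)
  have hlim' : Tendsto (fun t : ℝ ↦ K * ‖shrink M' t z' - shrink M' t z‖ ^ 2) (𝓝[<] 1) (𝓝 (K * ‖z' - z‖ ^ 2)) :=
    ((((tendsto_shrink M' z').sub (tendsto_shrink M' z)).norm.mono_left nhdsWithin_le_nhds).pow 2).const_mul K
  refine le_of_tendsto_of_tendsto hlim hlim' ?_
  filter_upwards [Ico_mem_nhdsLT (zero_lt_one' ℝ)] with t ht
  have ha := shrink_mem_openTri hM'0 ht hz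
  have hb := shrink_mem_openTri hM'0 ht hz'
  refine (D.norm_taylorRem_le_open hN hM' ha hb).trans ?_
  have hmono := modulus_mono hK hG₂ (norm_shrink_sub_shrink ht M' z z')
  exact mul_le_mul_of_nonneg_right hmono (sq_nonneg _)

/-! ### The test function and the `OrbmTestData` term -/

open scoped Classical in
/-- **The test function** `F = Re G` on the closed triangle `levelRegion N`, `0` outside.
[folklore] -/
def testF (N : ℝ) : ℂ → ℝ := (levelRegion N).piecewise (fun z ↦ (D.Gfun N z).re) fun _ ↦ 0

/-- Auxiliary statement (`testF_of_mem`). [folklore] -/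
theorem testF_of_mem {N : ℝ} {z : ℂ} (hz : z ∈ levelRegion N) : D.testF N z = (D.Gfun N z).re := by
  classical
  exact piecewise_eq_of_mem _ _ _ hz

/-- Auxiliary statement (`testF_of_not_mem`). [folklore] -/
theorem testF_of_not_mem {N : ℝ} {z : ℂ} (hz : z ∉ levelRegion N) : D.testF N z = 0 := by
  classical
  exact piecewise_eq_of_notMem _ _ _ hz

/-- Auxiliary statement (`measurable_testF`). [folklore] -/
theorem measurable_testF {N : ℝ} (hN : 0 < N) : Measurable (D.testF N) := by
  classical
  unfold testF
  exact ContinuousOn.measurable_piecewise (Complex.continuous_re.comp_continuousOn (D.continuousOn_Gfun hN))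
    continuousOn_const (isClosed_levelRegion N).measurableSet

/-- Auxiliary statement (`continuousOn_testF`). [folklore] -/
theorem continuousOn_testF {N : ℝ} (hN : 0 < N) : ContinuousOn (D.testF N) (levelRegion N) :=
  (Complex.continuous_re.comp_continuousOn (D.continuousOn_Gfun hN)).congr fun _ hz ↦ D.testF_of_mem hz

/-- The global bound of `F`. [folklore] -/
def CFbound (N : ℝ) : ℝ := normBound (D.Gfun N) (levelRegion N)

/-- Auxiliary statement (`abs_testF_le`). [folklore] -/
theorem abs_testF_le {N : ℝ} (hN : 0 < N) (z : ℂ) : |D.testF N z| ≤ D.CFbound N := by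
  by_cases hz : z ∈ levelRegion N
  · rw [D.testF_of_mem hz]
    exact (abs_re_le_norm _).trans (norm_le_normBound (isCompact_levelRegion N) (D.continuousOn_Gfun hN) hz)
  · rw [D.testF_of_not_mem hz, abs_zero]; exact normBound_nonneg _ _

/-- **The value at the apex**: `F(0) = Re Φ(∞)`. [folklore] -/
theorem testF_zero {N : ℝ} (hN : 0 ≤ N) : D.testF N 0 = (D.phiInf).re := by
  rw [D.testF_of_mem ⟨by simp [quadX], by simp [quadY], by simp [quadX, quadY]; exact hN⟩, Gfun_zero]

/-- **The values on the top side**: `F(oppositeSideParam N s) = Re Φₑ(scRatioInv s)`. [folklore] -/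
theorem testF_oppositeSideParam {N : ℝ} (hN : 0 < N) {s : ℝ} (hs : s ∈ Icc (0:ℝ) 1) :
    D.testF N (oppositeSideParam N s) = (D.phiExt (scRatioInv s)).re := by
  have hmem : oppositeSideParam N s ∈ levelRegion N := by
    refine ⟨?_, ?_, ?_⟩
    · rw [quadX_oppositeSideParam]; exact mul_nonneg hN.le (by linarith [hs.2])
    · rw [quadY_oppositeSideParam]; exact mul_nonneg hN.le hs.1
    · rw [quadX_oppositeSideParam, quadY_oppositeSideParam]; linarith
  have hne : oppositeSideParam N s ≠ 0 := by
    intro h0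
    have := congrArg (fun z ↦ quadX z + quadY z) h0
    simp only [quadX_oppositeSideParam, quadY_oppositeSideParam] at this
    have h2 : quadX (0:ℂ) + quadY 0 = 0 := by simp [quadX, quadY]
    rw [h2] at this
    nlinarith
  rw [D.testF_of_mem hmem, D.Gfun_of_ne N hne, wInv_oppositeSideParam hN hs]

/-- **The oblique harmonic test data** for the stopped Dynkin identity, at every level
`0 < M' < N`. [folklore] -/
def testData {N M' : ℝ} (hN : 0 < N) (hM'0 : 0 < M') (hM' : M' < N) : OrbmTestData M' where
  F := D.testF N
  f₁ z := (D.G₁fun N z).re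
  f₂ z := -(D.G₁fun N z).im
  f₁₁ z := (D.G₂fun N z).re
  f₁₂ z := -(D.G₂fun N z).im
  f₂₂ z := -(D.G₂fun N z).re
  C_F := D.CFbound N
  C₁ := max (D.C₁bound N M') (D.C₂bound N M')
  C₂ := D.C₂bound N M'
  ωbar := 2 * D.C₂bound N M'
  ω := D.omega N M'
  measurableF := D.measurable_testF hN
  absF_le := D.abs_testF_le hN
  abs_f₁_le z hz := (abs_re_le_norm _).trans ((norm_le_normBound (isCompact_levelRegion M')
    (D.continuousOn_G₁fun hN hM') hz).trans (le_max_left _ _))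
  abs_f₂_le z hz := by
    rw [abs_neg]
    exact (abs_im_le_norm _).trans ((norm_le_normBound (isCompact_levelRegion M') (D.continuousOn_G₁fun hN hM') hz).trans
      (le_max_left _ _))
  abs_f₁₁_le z hz := (abs_re_le_norm _).trans ((norm_le_normBound (isCompact_levelRegion M')
    (D.continuousOn_G₂fun hN hM') hz).trans (le_max_right _ _))
  abs_f₁₂_le z hz := by
    rw [abs_neg]
    exact (abs_im_le_norm _).trans ((norm_le_normBound (isCompact_levelRegion M') (D.continuousOn_G₂fun hN hM') hz).trans
      (le_max_right _ _))
  abs_f₂₂_le z hz := by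
    rw [abs_neg]
    exact (abs_re_le_norm _).trans ((norm_le_normBound (isCompact_levelRegion M') (D.continuousOn_G₂fun hN hM') hz).trans
      (le_max_right _ _))
  harmonic z _ := by ring
  bc₁ z hz := by
    have h := D.abs_re_G₁fun_mul_dirSixty_le hN hM'0 hM' hz
    have key : (D.G₁fun N z).re / 2 + Real.sqrt 3 / 2 * -(D.G₁fun N z).im = (D.G₁fun N z * dirSixty).re := by
      rw [mul_re, dirSixty_eq]; ring
    rw [key]; exact h
  bc₂ z hz := D.abs_re_G₁fun_le hN hM'0 hM' hz
  C₁_nonneg := le_max_of_le_left (normBound_nonneg _ _)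
  C₂_nonneg := normBound_nonneg _ _
  ω_nonneg r := modulus_nonneg _ _ r
  ω_mono := modulus_mono (isCompact_levelRegion M') (D.continuousOn_G₂fun hN hM')
  ω_le r := modulus_le (isCompact_levelRegion M') (D.continuousOn_G₂fun hN hM') r
  ω_tendsto := tendsto_modulus (isCompact_levelRegion M') (D.continuousOn_G₂fun hN hM')
  taylor z hz z' hz' := by
    have h := D.norm_taylorRem_le hN hM'0 hM' hz hz'
    have hre := D.re_taylorRem N z z'
    rw [D.testF_of_mem (levelRegion_mono hM'.le hz'), D.testF_of_mem (levelRegion_mono hM'.le hz)]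
    rw [← hre]
    exact (abs_re_le_norm _).trans h

/-- The test function of the test data is `testF`. [folklore] -/
@[simp] theorem testData_F {N M' : ℝ} (hN : 0 < N) (hM'0 : 0 < M') (hM' : M' < N) :
    (D.testData hN hM'0 hM').F = D.testF N := rfl

end TestIntervals

end Literature.Probability.RandomPlanarGeometry
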